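import Literature.NumberTheory.Automorphic.ModularLambdaDescent
import HarnessLib

/-!
# Holomorphic modular functions for `Γ(2)` are Laurent polynomials in `λ` and `1 − λ`

Sequel on the modular `λ`-function. Calegari–Dimitrov–Tang (F. Calegari, V. Dimitrov,
Y. Tang, *The unbounded denominators conjecture*, J. Amer. Math. Soc. **38** (2025),
arXiv:2109.09040), §4.2, sentence after Definition 22: "For example, the holomorphic modular
forms on `Y(2)` are given by `ℚ(λ^{±1}, (1 − λ)^{±1})` and the `ℚ(λ)`-vector space generated by
such elements inside `ℚ((q^{1/N}))` is `M_2 = ℚ(λ)`." Here a *holomorphic modular form on `Y(2)`*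
is a holomorphic function on `ℍ`, invariant under `Γ(2)` (weight `0`), and MEROMORPHIC at the
three cusps. We prove the analytic statement over `ℂ`:

* `exists_polynomial_of_norm_le_mul_pow` — an entire function with `‖f(z)‖ ≤ A(1 + ‖z‖)ᴺ` for
  `‖z‖` large is a polynomial of degree `≤ N` (Cauchy's estimates + Taylor expansion; the
  generalised Liouville theorem);
* `pow_mul_norm_factor_le_near_zero` — weighted form of `norm_factor_le_near_zero`
  (`ModularLambdaDescent.lean`): if `F = G ∘ λ` and `‖F(τ)‖ ≤ C e^{πk Im τ}` high up, then
  `‖w‖ᵏ ‖G(w)‖` is bounded near `0` (as `|λ(τ)| < 17 e^{−π Im τ}` high up);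
* **`exists_polynomial_of_Gamma_two_invariant`** — a `Γ(2)`-invariant holomorphic `F` on `ℍ`
  with `F(τ)`, `F(−1/τ)`, `F(1 − 1/τ)` all `O(e^{πk Im τ})` as `Im τ → ∞` (poles of order `≤ k`
  at the cusps `∞, 0, 1` in the local parameters `q = e^{πiτ}`) satisfies
  `F · λᵏ(1 − λ)ᵏ = P(λ)` for a polynomial `P` of degree `≤ 3k`; i.e.
  **`F ∈ ℂ[λ, λ⁻¹, (1 − λ)⁻¹]`**, `F = P(λ)/(λᵏ(1−λ)ᵏ)`.

No definitions, no named facts.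

## References

* [CalegariDimitrovTang2025] arXiv:2109.09040, §4.2, Definition 22 and the sentence after it.
* F. Diamond, J. Shurman, *A First Course in Modular Forms*, §3.5–3.6, §7.5 (`ℂ(X(2)) = ℂ(λ)`).
-/

noncomputable section

open Complex Filter Topology Function Metric Set
open UpperHalfPlane hiding I
open scoped Real Topology MatrixGroups Modular

namespace Literature.NumberTheory.Automorphic

namespace ModularLambda

open Literature.NumberTheory.EllipticCurves.JacobiThetaNull
open CongruenceSubgroup ModularGroup

/-! ### Entire functions of polynomial growth are polynomials -/

/-- **Generalised Liouville.** An entire function with `‖f(z)‖ ≤ A (1 + ‖z‖)ᴺ` for `‖z‖ ≥ R₀` is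
a polynomial of degree at most `N` (Cauchy's estimate on large circles kills the Taylor
coefficients beyond `N`). [folklore] -/
theorem exists_polynomial_of_norm_le_mul_pow {f : ℂ → ℂ} (hf : Differentiable ℂ f) {A R₀ : ℝ}
    {N : ℕ} (hgrowth : ∀ z : ℂ, R₀ ≤ ‖z‖ → ‖f z‖ ≤ A * (1 + ‖z‖) ^ N) :
    ∃ P : Polynomial ℂ, P.natDegree ≤ N ∧ ∀ z : ℂ, f z = P.eval z := by
  -- the Taylor coefficients beyond `N` vanish
  have hzero : ∀ n : ℕ, N < n → iteratedDeriv n f 0 = 0 := by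
    intro n hn
    have hA : 0 ≤ A := by
      have h := hgrowth ((max R₀ 1 : ℝ) : ℂ)
        (by rw [Complex.norm_real, Real.norm_eq_abs, abs_of_pos (by positivity)]
            exact le_max_left _ _)
      have : 0 < (1 + ‖((max R₀ 1 : ℝ) : ℂ)‖) ^ N := by positivity
      nlinarith [norm_nonneg (f ((max R₀ 1 : ℝ) : ℂ))]
    -- `‖f⁽ⁿ⁾(0)‖ ≤ n! A 2ᴺ / R^{n-N}` for every `R ≥ max R₀ 1`
    have hest : ∀ R : ℝ, max R₀ 1 ≤ R →
        ‖iteratedDeriv n f 0‖ ≤ n.factorial * (A * 2 ^ N) / R ^ (n - N) := by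
      intro R hR
      have hR1 : 1 ≤ R := (le_max_right _ _).trans hR
      have hRpos : 0 < R := by linarith
      have hC : ∀ z ∈ sphere (0 : ℂ) R, ‖f z‖ ≤ A * 2 ^ N * R ^ N := by
        intro z hz
        rw [mem_sphere_zero_iff_norm] at hz
        refine (hgrowth z (by rw [hz]; exact (le_max_left _ _).trans hR)).trans ?_
        rw [hz, mul_assoc]
        gcongr
        rw [← mul_pow]
        exact pow_le_pow_left₀ (by positivity) (by linarith) N
      have h := Complex.norm_iteratedDeriv_le_of_forall_mem_sphere_norm_le n hRpos
        (hf.differentiableOn.diffContOnCl) hC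
      refine h.trans (le_of_eq ?_)
      have hsplit : R ^ n = R ^ (n - N) * R ^ N := by
        rw [← pow_add, Nat.sub_add_cancel hn.le]
      rw [hsplit]
      field_simp
    -- let `R → ∞`
    have hlim : Tendsto (fun R : ℝ ↦ (n.factorial : ℝ) * (A * 2 ^ N) / R ^ (n - N)) atTop
        (𝓝 0) := by
      have hnN : 0 < n - N := Nat.sub_pos_of_lt hn
      have h := (tendsto_pow_atTop hnN.ne').inv_tendsto_atTop.const_mul
        ((n.factorial : ℝ) * (A * 2 ^ N))
      rw [mul_zero] at h
      refine h.congr fun R ↦ ?_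
      simp only [Pi.inv_apply, div_eq_mul_inv]
    have hle : ‖iteratedDeriv n f 0‖ ≤ 0 :=
      ge_of_tendsto hlim (eventually_atTop.mpr ⟨max R₀ 1, fun R hR ↦ hest R hR⟩)
    exact norm_le_zero_iff.mp hle
  -- the Taylor polynomial
  refine ⟨∑ n ∈ Finset.range (N + 1),
    Polynomial.monomial n ((n.factorial : ℂ)⁻¹ * iteratedDeriv n f 0), ?_, fun z ↦ ?_⟩
  · refine Polynomial.natDegree_sum_le_of_forall_le _ _ fun n hn ↦ ?_
    exact (Polynomial.natDegree_monomial_le _).trans (Nat.lt_succ_iff.mp (Finset.mem_range.mp hn))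
  · rw [← Complex.taylorSeries_eq_of_entire' 0 z hf, Polynomial.eval_finsetSum]
    simp only [Polynomial.eval_monomial, sub_zero]
    refine tsum_eq_sum fun n hn ↦ ?_
    rw [Finset.mem_range, not_lt] at hn
    rw [hzero n (Nat.lt_of_succ_le hn), mul_zero, zero_mul]

/-! ### The weighted bound near `0` -/

/-- **`|λ(τ)| < 17 e^{−π Im τ}` high in the upper half-plane** (`e^{−πiτ}λ(τ) → 16`).
[folklore] -/
theorem exists_forall_norm_modularLambda_lt_exp :
    ∃ B : ℝ, ∀ τ : ℂ, B ≤ τ.im → ‖modularLambda τ‖ < 17 * Real.exp (-(π * τ.im)) := by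
  have hev : ∀ᶠ τ : ℂ in comap im atTop, cexp (-(π * I * τ)) * modularLambda τ ∈
      ball (16 : ℂ) 1 := tendsto_exp_mul_modularLambda (ball_mem_nhds _ one_pos)
  obtain ⟨B, hB⟩ := eventually_atTop.mp (Filter.eventually_comap.mp hev)
  refine ⟨B, fun τ hτ ↦ ?_⟩
  have h := hB τ.im hτ τ rfl
  rw [mem_ball, dist_eq_norm] at h
  have h17 : ‖cexp (-(π * I * τ)) * modularLambda τ‖ < 17 := by
    have := norm_sub_norm_le (cexp (-(π * I * τ)) * modularLambda τ) 16
    have h16 : ‖(16 : ℂ)‖ = 16 := by norm_num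
    linarith
  rw [norm_mul, Complex.norm_exp] at h17
  have hre : (-(π * I * τ)).re = π * τ.im := by
    simp [Complex.mul_re, Complex.mul_im, Complex.I_re, Complex.I_im]
  rw [hre] at h17
  have hpos : 0 < Real.exp (π * τ.im) := Real.exp_pos _
  rw [Real.exp_neg, ← div_eq_mul_inv, lt_div_iff₀ hpos, mul_comm]
  exact h17

/-- **Weighted bound near `0`.** If `F = G ∘ λ` on `ℍ` and `‖F(τ)‖ ≤ C e^{πk Im τ}` high in the
upper half-plane, then `‖w‖ᵏ ‖G(w)‖` is bounded for `w` near `0` (same analysis as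
`norm_factor_le_near_zero`, using `|λ| < 17 e^{−π Im}`). [folklore] -/
theorem pow_mul_norm_factor_le_near_zero {F G : ℂ → ℂ} (k : ℕ)
    (hFG : ∀ τ : ℂ, 0 < τ.im → F τ = G (modularLambda τ))
    (hbd : ∃ B C : ℝ, ∀ τ : ℂ, B ≤ τ.im → ‖F τ‖ ≤ C * Real.exp (π * k * τ.im)) :
    ∃ δ > 0, ∃ M : ℝ, ∀ w : ℂ, ‖w‖ < δ → w ≠ 0 → w ≠ 1 → ‖w‖ ^ k * ‖G w‖ ≤ M := by
  obtain ⟨B, C, hBC⟩ := hbd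
  obtain ⟨B₁, hB₁⟩ := exists_forall_norm_modularLambda_lt_exp
  obtain ⟨ε, hε, R, hR, η, hη, hD⟩ := modularLambda_fd_bounds (max B B₁)
  have hR1 : 0 < R + 1 := by linarith
  -- the bound high up: `‖λ σ'‖ ≤ 17 e^{-π y}/c` and `‖F σ‖ ≤ |C| e^{πky}` give `≤ (17/c)^k |C|`
  have hkey : ∀ (σ : ℂ) (x : ℂ) (c : ℝ), 0 < c → max B B₁ < σ.im →
      ‖x‖ ≤ 17 * Real.exp (-(π * σ.im)) / c →
      ‖x‖ ^ k * ‖F σ‖ ≤ (17 / c) ^ k * |C| := by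
    intro σ x c hc hσ hx
    have hσB : B ≤ σ.im := (le_max_left _ _).trans hσ.le
    have hF : ‖F σ‖ ≤ |C| * Real.exp (π * k * σ.im) :=
      (hBC σ hσB).trans (mul_le_mul_of_nonneg_right (le_abs_self C) (Real.exp_pos _).le)
    have hxk : ‖x‖ ^ k ≤ (17 / c) ^ k * Real.exp (-(π * σ.im)) ^ k := by
      rw [← mul_pow]
      exact pow_le_pow_left₀ (norm_nonneg _) (by rw [div_mul_eq_mul_div]; exact hx) k
    have hexp : Real.exp (-(π * σ.im)) ^ k * Real.exp (π * k * σ.im) = 1 := by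
      rw [← Real.exp_nat_mul, ← Real.exp_add]
      convert Real.exp_zero using 2
      ring
    calc ‖x‖ ^ k * ‖F σ‖
        ≤ ((17 / c) ^ k * Real.exp (-(π * σ.im)) ^ k) * (|C| * Real.exp (π * k * σ.im)) :=
          mul_le_mul hxk hF (norm_nonneg _) (by positivity)
      _ = (17 / c) ^ k * |C| * (Real.exp (-(π * σ.im)) ^ k * Real.exp (π * k * σ.im)) := by
          ring
      _ = (17 / c) ^ k * |C| := by rw [hexp, mul_one]
  refine ⟨min (min (1 / 2) (η / 2)) (min (1 / (R + 1)) (ε / (R + 1))), by positivity,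
    max ((17 / 1) ^ k * |C|) ((17 / η) ^ k * |C|), fun w hw hw0 hw1 ↦ ?_⟩
  have hw_half : ‖w‖ < 1 / 2 := lt_of_lt_of_le hw ((min_le_left _ _).trans (min_le_left _ _))
  have hw_eta : ‖w‖ < η / 2 := lt_of_lt_of_le hw ((min_le_left _ _).trans (min_le_right _ _))
  have hw_R : ‖w‖ < 1 / (R + 1) := lt_of_lt_of_le hw ((min_le_right _ _).trans (min_le_left _ _))
  have hw_eps : ‖w‖ < ε / (R + 1) :=
    lt_of_lt_of_le hw ((min_le_right _ _).trans (min_le_right _ _))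
  -- a preimage, moved to the fundamental domain
  obtain ⟨τ, hτ, hτw⟩ := exists_modularLambda_eq hw0 hw1
  obtain ⟨g, hg⟩ := ModularGroup.exists_smul_mem_fd ⟨τ, hτ⟩
  set z : ℍ := g • ⟨τ, hτ⟩ with hz
  have hz0 : 0 < im (z : ℂ) := z.2
  obtain ⟨hzε, hzR, hzη⟩ := hD z hz0 hg.1 hg.2
  have hx0 : modularLambda (z : ℂ) ≠ 0 := modularLambda_ne_zero hz0
  have hx1 : modularLambda (z : ℂ) - 1 ≠ 0 := sub_ne_zero.mpr (modularLambda_ne_one hz0)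
  have hcoe : τ = ((g⁻¹ • z : ℍ) : ℂ) := by rw [hz, inv_smul_smul]
  have h6 := modularLambda_smul_eq_or g⁻¹ z
  rw [← hcoe, hτw] at h6
  have hεle : ε / (R + 1) ≤ ε := div_le_self hε.le (by linarith)
  have hdecay : ∀ σ : ℂ, max B B₁ < σ.im →
      ‖modularLambda σ‖ ≤ 17 * Real.exp (-(π * σ.im)) :=
    fun σ hσ ↦ (hB₁ σ ((le_max_right _ _).trans hσ.le)).le
  -- the anharmonic six
  rcases h6 with h | h | h | h | h | h
  · -- `w = x`: `z` is high
    have hhigh : max B B₁ < (z : ℂ).im := hzε (by rw [← h]; linarith)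
    rw [h, ← hFG _ hz0]
    refine (hkey z _ 1 one_pos hhigh (by rw [div_one]; exact hdecay _ hhigh)).trans
      (le_max_left _ _)
  · -- `w = 1 - x`: impossible, `‖1 - x‖ ≥ η`
    exfalso
    rw [h, norm_sub_rev] at hw_eta
    linarith
  · -- `w = x⁻¹`: impossible, `‖x‖ ≤ R`
    exfalso
    rw [h, norm_inv, one_div] at hw_R
    have hxpos : 0 < ‖modularLambda (z : ℂ)‖ := norm_pos_iff.mpr hx0
    have := (inv_lt_inv₀ hxpos hR1).mp hw_R
    linarith
  · -- `w = (1 - x)⁻¹`: impossible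
    exfalso
    rw [h, norm_inv, one_div] at hw_R
    have h1x : 0 < ‖1 - modularLambda (z : ℂ)‖ :=
      norm_pos_iff.mpr (fun h' ↦ hx1 (by linear_combination -h'))
    have := (inv_lt_inv₀ h1x hR1).mp hw_R
    have : ‖1 - modularLambda (z : ℂ)‖ ≤ 1 + ‖modularLambda (z : ℂ)‖ :=
      (norm_sub_le _ _).trans (by rw [norm_one])
    linarith
  · -- `w = 1 - x⁻¹`: impossible, forces `x` near `1`
    exfalso
    rw [h] at hw_eta hw_half
    have hxpos : 0 < ‖modularLambda (z : ℂ)‖ := norm_pos_iff.mpr hx0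
    have hxinv : 1 / 2 ≤ ‖(modularLambda (z : ℂ))⁻¹‖ := by
      have := norm_sub_norm_le (1 : ℂ) (1 - (modularLambda (z : ℂ))⁻¹)
      rw [sub_sub_cancel, norm_one] at this
      linarith
    have hxle : ‖modularLambda (z : ℂ)‖ ≤ 2 := by
      rw [norm_inv, le_inv_comm₀ (by norm_num) hxpos] at hxinv
      linarith
    have hk' : ‖modularLambda (z : ℂ) - 1‖ =
        ‖modularLambda (z : ℂ)‖ * ‖1 - (modularLambda (z : ℂ))⁻¹‖ := by
      rw [← norm_mul, mul_sub, mul_one, mul_inv_cancel₀ hx0]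
    have : ‖modularLambda (z : ℂ)‖ * ‖1 - (modularLambda (z : ℂ))⁻¹‖ < η :=
      calc ‖modularLambda (z : ℂ)‖ * ‖1 - (modularLambda (z : ℂ))⁻¹‖
          ≤ 2 * ‖1 - (modularLambda (z : ℂ))⁻¹‖ := by gcongr
        _ < 2 * (η / 2) := by gcongr
        _ = η := by ring
    linarith
  · -- `w = 1 - (1 - x)⁻¹ = x/(x-1) = λ(T z)`: `z` is high, `‖w‖ ≤ ‖x‖/η`
    have hx1' : 1 - modularLambda (z : ℂ) ≠ 0 := fun h' ↦ hx1 (by linear_combination -h')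
    have hq : 1 - (1 - modularLambda (z : ℂ))⁻¹ =
        modularLambda (z : ℂ) / (modularLambda (z : ℂ) - 1) := by
      field_simp
      ring
    have hx1pos : 0 < ‖modularLambda (z : ℂ) - 1‖ := norm_pos_iff.mpr hx1
    -- `‖x‖ < ε`, so `z` is high
    have hxε : ‖modularLambda (z : ℂ)‖ < ε := by
      rw [h, hq, norm_div, div_lt_iff₀ hx1pos] at hw_eps
      have hx1le : ‖modularLambda (z : ℂ) - 1‖ ≤ R + 1 :=
        (norm_sub_le _ _).trans (by rw [norm_one]; linarith)
      calc ‖modularLambda (z : ℂ)‖ < ε / (R + 1) * ‖modularLambda (z : ℂ) - 1‖ := hw_eps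
        _ ≤ ε / (R + 1) * (R + 1) := by gcongr
        _ = ε := div_mul_cancel₀ ε hR1.ne'
    have hhigh : max B B₁ < (z : ℂ).im := hzε hxε
    have him : ((ModularGroup.T • z : ℍ) : ℂ).im = (z : ℂ).im := by
      rw [modular_T_smul, coe_vadd]
      simp
    have hhigh' : max B B₁ < ((ModularGroup.T • z : ℍ) : ℂ).im := by rwa [him]
    -- `‖w‖ ≤ 17 e^{-π y}/η`
    have hwle : ‖w‖ ≤ 17 * Real.exp (-(π * ((ModularGroup.T • z : ℍ) : ℂ).im)) / η := by
      rw [him, h, hq, norm_div]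
      rw [le_div_iff₀ hη]
      calc ‖modularLambda (z : ℂ)‖ / ‖modularLambda (z : ℂ) - 1‖ * η
          ≤ ‖modularLambda (z : ℂ)‖ / ‖modularLambda (z : ℂ) - 1‖ *
              ‖modularLambda (z : ℂ) - 1‖ := by gcongr
        _ = ‖modularLambda (z : ℂ)‖ := div_mul_cancel₀ _ hx1pos.ne'
        _ ≤ 17 * Real.exp (-(π * (z : ℂ).im)) := hdecay _ hhigh
    have hGw : G w = F ((ModularGroup.T • z : ℍ) : ℂ) := by
      rw [h, ← modularLambda_T_smul, ← hFG _ (ModularGroup.T • z).2]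
    rw [hGw]
    exact (hkey _ w η hη hhigh' hwle).trans (le_max_right _ _)

/-! ### The main theorem -/

/-- Removing an isolated singularity of a function bounded near it, keeping differentiability
elsewhere: if `f` is differentiable on the open set `U`, `c ∉ U`, `U ∪ {c}` is a neighbourhood of
`c` and `f` is bounded on a punctured neighbourhood of `c` inside `U`, then some `g` agreeing with
`f` on `U` is differentiable on `U ∪ {c}`. [folklore] -/
private theorem exists_extend_of_bounded {f : ℂ → ℂ} {U : Set ℂ} {c : ℂ} (hU : IsOpen U)
    (hcU : c ∉ U) (hf : DifferentiableOn ℂ f U) {r : ℝ} (hr : 0 < r)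
    (hball : ball c r \ {c} ⊆ U) {M : ℝ} (hM : ∀ z ∈ ball c r \ {c}, ‖f z‖ ≤ M) :
    ∃ g : ℂ → ℂ, DifferentiableOn ℂ g (U ∪ {c}) ∧ ∀ z ∈ U, g z = f z := by
  refine ⟨update f c (limUnder (𝓝[≠] c) f), ?_,
    fun z hz ↦ update_of_ne (fun h ↦ hcU (by rw [h] at hz; exact hz)) ..⟩
  have hloc : DifferentiableOn ℂ (update f c (limUnder (𝓝[≠] c) f)) (ball c r) :=
    differentiableOn_update_limUnder_of_bddAbove (ball_mem_nhds c hr) (hf.mono hball)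
      ⟨M, by rintro _ ⟨z, hz, rfl⟩; exact hM z hz⟩
  intro z hz
  rcases hz with hz | hz
  · -- `z ∈ U`, `z ≠ c`: `update f c _ = f` near `z`
    have hzc : z ≠ c := fun h ↦ hcU (by rw [h] at hz; exact hz)
    have heq : update f c (limUnder (𝓝[≠] c) f) =ᶠ[𝓝 z] f := by
      filter_upwards [isOpen_compl_singleton.mem_nhds hzc] with y hy
      exact update_of_ne hy ..
    exact (heq.differentiableAt_iff.mpr
      (hf.differentiableAt (hU.mem_nhds hz))).differentiableWithinAt
  · rw [mem_singleton_iff] at hz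
    subst hz
    exact (hloc.differentiableAt (ball_mem_nhds _ hr)).differentiableWithinAt

/-- **Holomorphic modular functions of weight `0` for `Γ(2)`, meromorphic at the cusps, are
Laurent polynomials in `λ`, `1 − λ`.** Let `F` be holomorphic on `ℍ`, invariant under `Γ(2)`, with
`F(τ)`, `F(−1/τ)`, `F(1 − 1/τ)` all `O(e^{πk Im τ})` as `Im τ → ∞` (poles of order `≤ k` at the
cusps `∞`, `0`, `1` in the parameters `e^{πiτ}`). Then `F · λᵏ (1 − λ)ᵏ = P(λ)` on `ℍ` for a
polynomial `P` of degree `≤ 3k`; i.e. `F = P(λ)/(λᵏ(1 − λ)ᵏ) ∈ ℂ[λ, λ⁻¹, (1−λ)⁻¹]`.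
[cite: CalegariDimitrovTang2025, §4.2, sentence following Definition 22] -/
theorem exists_polynomial_of_Gamma_two_invariant {F : ℂ → ℂ} (k : ℕ)
    (hF : DifferentiableOn ℂ F {z : ℂ | 0 < z.im})
    (hinv : ∀ γ ∈ CongruenceSubgroup.Gamma 2, ∀ z : ℍ, F ((γ • z : ℍ) : ℂ) = F z)
    (hinf : ∃ B C : ℝ, ∀ τ : ℂ, B ≤ τ.im → ‖F τ‖ ≤ C * Real.exp (π * k * τ.im))
    (h0 : ∃ B C : ℝ, ∀ τ : ℂ, B ≤ τ.im → ‖F (-1 / τ)‖ ≤ C * Real.exp (π * k * τ.im))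
    (h1 : ∃ B C : ℝ, ∀ τ : ℂ, B ≤ τ.im → ‖F (1 - 1 / τ)‖ ≤ C * Real.exp (π * k * τ.im)) :
    ∃ P : Polynomial ℂ, P.natDegree ≤ 3 * k ∧ ∀ τ : ℂ, 0 < τ.im →
      F τ * (modularLambda τ ^ k * (1 - modularLambda τ) ^ k) = P.eval (modularLambda τ) := by
  obtain ⟨G, hGd, hFG⟩ := exists_factor_of_Gamma_two_invariant hF hinv
  -- the factors of `F ∘ S` and `F ∘ TS`
  have hFG0 : ∀ τ : ℂ, 0 < τ.im → F (-1 / τ) = G (1 - modularLambda τ) := by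
    intro τ hτ
    have h := hFG _ (ModularGroup.S • (⟨τ, hτ⟩ : ℍ)).2
    rw [modularLambda_S_smul] at h
    rw [← h, modular_S_smul, coe_mk, inv_neg, neg_div, one_div]
  have hFG1 : ∀ τ : ℂ, 0 < τ.im → F (1 - 1 / τ) = G (1 - (modularLambda τ)⁻¹) := by
    intro τ hτ
    have h := hFG _ ((ModularGroup.T * ModularGroup.S) • (⟨τ, hτ⟩ : ℍ)).2
    rw [modularLambda_TS_smul] at h
    rw [← h, mul_smul, modular_T_smul, coe_vadd, modular_S_smul, coe_mk, inv_neg, one_div]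
    push_cast
    rw [sub_eq_add_neg]
  obtain ⟨δ₀, hδ₀, M₀, hM₀⟩ := pow_mul_norm_factor_le_near_zero k hFG hinf
  obtain ⟨δ₁, hδ₁, M₁, hM₁⟩ :=
    pow_mul_norm_factor_le_near_zero k (G := fun w ↦ G (1 - w)) hFG0 h0
  obtain ⟨δ₂, hδ₂, M₂, hM₂⟩ :=
    pow_mul_norm_factor_le_near_zero k (G := fun w ↦ G (1 - w⁻¹)) hFG1 h1
  -- `H = wᵏ (1-w)ᵏ G` has polynomial growth on `ℂ ∖ {0,1}`
  set H : ℂ → ℂ := fun w ↦ w ^ k * (1 - w) ^ k * G w with hH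
  have hHd : DifferentiableOn ℂ H ({0, 1}ᶜ : Set ℂ) :=
    ((differentiableOn_id.pow k).mul
      ((differentiableOn_const 1).sub differentiableOn_id |>.pow k)).mul hGd
  have hM₀' : 0 ≤ max M₀ 0 := le_max_right _ _
  have hbd0 : ∀ w : ℂ, ‖w‖ < δ₀ → w ≠ 0 → w ≠ 1 → ‖H w‖ ≤ (1 + δ₀) ^ k * max M₀ 0 := by
    intro w hw hw0 hw1
    have h := (hM₀ w hw hw0 hw1).trans (le_max_left M₀ 0)
    simp only [hH, norm_mul, norm_pow]
    have h1w : ‖1 - w‖ ≤ 1 + δ₀ := (norm_sub_le _ _).trans (by rw [norm_one]; linarith)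
    calc ‖w‖ ^ k * ‖1 - w‖ ^ k * ‖G w‖ = ‖1 - w‖ ^ k * (‖w‖ ^ k * ‖G w‖) := by ring
      _ ≤ (1 + δ₀) ^ k * max M₀ 0 := by
          gcongr
  have hbd1 : ∀ w : ℂ, ‖w - 1‖ < δ₁ → w ≠ 0 → w ≠ 1 → ‖H w‖ ≤ (1 + δ₁) ^ k * max M₁ 0 := by
    intro w hw hw0 hw1
    have h := hM₁ (1 - w) (by rwa [norm_sub_rev]) (sub_ne_zero.mpr (Ne.symm hw1))
      (fun h ↦ hw0 (by linear_combination -h))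
    simp only [sub_sub_cancel] at h
    have h' := h.trans (le_max_left M₁ 0)
    simp only [hH, norm_mul, norm_pow]
    have hw' : ‖w‖ ≤ 1 + δ₁ := by
      have := norm_sub_norm_le w 1
      rw [norm_one] at this
      linarith
    calc ‖w‖ ^ k * ‖1 - w‖ ^ k * ‖G w‖ = ‖w‖ ^ k * (‖1 - w‖ ^ k * ‖G w‖) := by ring
      _ ≤ (1 + δ₁) ^ k * max M₁ 0 := by
          gcongr
  have hbd2 : ∀ w : ℂ, 2 / δ₂ + 2 < ‖w‖ → w ≠ 0 → w ≠ 1 →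
      ‖H w‖ ≤ max M₂ 0 * (1 + ‖w‖) ^ (3 * k) := by
    intro w hw hw0 hw1
    have hw1' : 1 - w ≠ 0 := sub_ne_zero.mpr (Ne.symm hw1)
    have hularge : 2 / δ₂ < ‖1 - w‖ := by
      have := norm_sub_norm_le w 1
      rw [norm_one, norm_sub_rev] at this
      linarith
    have hupos : 0 < ‖1 - w‖ := norm_pos_iff.mpr hw1'
    have hu : ‖(1 - w)⁻¹‖ < δ₂ := by
      rw [norm_inv, inv_lt_comm₀ hupos hδ₂]
      have : δ₂⁻¹ ≤ 2 / δ₂ := by rw [div_eq_mul_inv]; linarith [inv_pos.mpr hδ₂]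
      linarith
    have h := hM₂ (1 - w)⁻¹ hu (inv_ne_zero hw1') (by
      intro h
      have : 1 - w = 1 := by rw [← inv_inv (1 - w), h, inv_one]
      exact hw0 (by linear_combination -this))
    simp only [inv_inv, sub_sub_cancel] at h
    have h' := h.trans (le_max_left M₂ 0)
    -- `‖G w‖ ≤ max M₂ 0 * ‖1 - w‖ ^ k`
    rw [norm_inv, inv_pow, inv_mul_le_iff₀ (pow_pos hupos k)] at h'
    simp only [hH, norm_mul, norm_pow]
    have h1w : ‖1 - w‖ ≤ 1 + ‖w‖ := (norm_sub_le _ _).trans (by rw [norm_one])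
    have hw' : ‖w‖ ≤ 1 + ‖w‖ := by linarith [norm_nonneg w]
    calc ‖w‖ ^ k * ‖1 - w‖ ^ k * ‖G w‖
        ≤ (1 + ‖w‖) ^ k * (1 + ‖w‖) ^ k * (‖1 - w‖ ^ k * max M₂ 0) := by gcongr
      _ ≤ (1 + ‖w‖) ^ k * (1 + ‖w‖) ^ k * ((1 + ‖w‖) ^ k * max M₂ 0) := by gcongr
      _ = max M₂ 0 * (1 + ‖w‖) ^ (3 * k) := by ring
  -- the compact middle region
  set K : Set ℂ := {w : ℂ | δ₀ / 2 ≤ ‖w‖ ∧ δ₁ / 2 ≤ ‖w - 1‖ ∧ ‖w‖ ≤ 2 / δ₂ + 2} with hK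
  have hKc : IsCompact K := by
    refine Metric.isCompact_of_isClosed_isBounded ?_ ?_
    · simp only [hK, Set.setOf_and]
      exact (isClosed_le continuous_const continuous_norm).inter
        ((isClosed_le continuous_const (continuous_id.sub continuous_const).norm).inter
          (isClosed_le continuous_norm continuous_const))
    · exact (Metric.isBounded_iff_subset_closedBall 0).mpr
        ⟨2 / δ₂ + 2, fun w hw ↦ mem_closedBall_zero_iff.mpr hw.2.2⟩
  have hK01 : K ⊆ ({0, 1}ᶜ : Set ℂ) := by
    intro w hw
    simp only [mem_compl_iff, mem_insert_iff, mem_singleton_iff, not_or]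
    constructor
    · intro h
      have h' := hw.1
      rw [h, norm_zero] at h'
      linarith
    · intro h
      have h' := hw.2.1
      rw [h, sub_self, norm_zero] at h'
      linarith
  obtain ⟨M₃, hM₃⟩ : ∃ M₃, ∀ w ∈ K, ‖H w‖ ≤ M₃ := by
    have hc : ContinuousOn (fun w ↦ ‖H w‖) K := (hHd.continuousOn.mono hK01).norm
    rcases K.eq_empty_or_nonempty with hKe | hKne
    · exact ⟨0, fun w hw ↦ by simp [hKe] at hw⟩
    · obtain ⟨w₀, -, hmax⟩ := hKc.exists_isMaxOn hKne hc
      exact ⟨‖H w₀‖, fun w hw ↦ hmax hw⟩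
  -- global polynomial bound on `ℂ ∖ {0,1}`
  set A : ℝ := max (max ((1 + δ₀) ^ k * max M₀ 0) ((1 + δ₁) ^ k * max M₁ 0))
    (max (max M₂ 0) (max M₃ 0)) with hA
  have hA0 : 0 ≤ A := (le_max_right _ _).trans ((le_max_right _ _).trans (le_max_right _ _))
  have hgrowth : ∀ w : ℂ, w ≠ 0 → w ≠ 1 → ‖H w‖ ≤ A * (1 + ‖w‖) ^ (3 * k) := by
    intro w hw0 hw1
    have hone : 1 ≤ (1 + ‖w‖) ^ (3 * k) := one_le_pow₀ (by linarith [norm_nonneg w])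
    have hle : ∀ t : ℝ, t ≤ A → t ≤ A * (1 + ‖w‖) ^ (3 * k) := fun t ht ↦
      ht.trans (le_mul_of_one_le_right hA0 hone)
    by_cases ha : ‖w‖ < δ₀
    · exact hle _ ((hbd0 w ha hw0 hw1).trans ((le_max_left _ _).trans (le_max_left _ _)))
    by_cases hb : ‖w - 1‖ < δ₁
    · exact hle _ ((hbd1 w hb hw0 hw1).trans ((le_max_right _ _).trans (le_max_left _ _)))
    by_cases hc : 2 / δ₂ + 2 < ‖w‖
    · refine (hbd2 w hc hw0 hw1).trans ?_
      gcongr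
      exact (le_max_left _ _).trans (le_max_right _ _)
    · have hwK : w ∈ K := ⟨by linarith [not_lt.mp ha], by linarith [not_lt.mp hb], not_lt.mp hc⟩
      exact hle _ ((hM₃ w hwK).trans ((le_max_left _ _).trans
        ((le_max_right _ _).trans (le_max_right _ _))))
  -- remove the singularities at `0` and `1`
  have hU : IsOpen ({0, 1}ᶜ : Set ℂ) := (Set.toFinite {(0 : ℂ), 1}).isClosed.isOpen_compl
  obtain ⟨H₁, hH₁d, hH₁eq⟩ : ∃ H₁ : ℂ → ℂ, DifferentiableOn ℂ H₁ ({1}ᶜ : Set ℂ) ∧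
      ∀ w ∈ ({0, 1}ᶜ : Set ℂ), H₁ w = H w := by
    have hball : ball (0 : ℂ) (1 / 2) \ {0} ⊆ ({0, 1}ᶜ : Set ℂ) := by
      intro w hw
      simp only [Set.mem_sdiff, mem_ball, dist_zero_right, mem_singleton_iff] at hw
      simp only [mem_compl_iff, mem_insert_iff, mem_singleton_iff, not_or]
      refine ⟨hw.2, fun h ↦ ?_⟩
      rw [h, norm_one] at hw
      linarith [hw.1]
    obtain ⟨g, hg, hgeq⟩ := exists_extend_of_bounded hU (by simp) hHd (by norm_num : (0:ℝ) < 1/2)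
      hball (M := A * (1 + 1 / 2) ^ (3 * k)) (fun w hw ↦ by
        have hw' := hball hw
        simp only [mem_compl_iff, mem_insert_iff, mem_singleton_iff, not_or] at hw'
        refine (hgrowth w hw'.1 hw'.2).trans ?_
        have : ‖w‖ < 1 / 2 := by simpa using hw.1
        gcongr)
    refine ⟨g, ?_, hgeq⟩
    have : ({0, 1}ᶜ : Set ℂ) ∪ {0} = ({1}ᶜ : Set ℂ) := by
      ext w
      simp only [mem_union, mem_compl_iff, mem_insert_iff, mem_singleton_iff, not_or]
      constructor
      · rintro (⟨-, h⟩ | h)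
        · exact h
        · rw [h]
          exact zero_ne_one
      · intro h
        by_cases hw : w = 0
        · exact Or.inr hw
        · exact Or.inl ⟨hw, h⟩
    rwa [this] at hg
  obtain ⟨H₂, hH₂d, hH₂eq⟩ : ∃ H₂ : ℂ → ℂ, Differentiable ℂ H₂ ∧
      ∀ w ∈ ({0, 1}ᶜ : Set ℂ), H₂ w = H w := by
    have hball : ball (1 : ℂ) (1 / 2) \ {1} ⊆ ({1}ᶜ : Set ℂ) := fun w hw ↦ hw.2
    have hball' : ball (1 : ℂ) (1 / 2) \ {1} ⊆ ({0, 1}ᶜ : Set ℂ) := by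
      intro w hw
      simp only [Set.mem_sdiff, mem_ball, mem_singleton_iff] at hw
      simp only [mem_compl_iff, mem_insert_iff, mem_singleton_iff, not_or]
      refine ⟨fun h ↦ ?_, hw.2⟩
      rw [h, dist_zero_left, norm_one] at hw
      linarith [hw.1]
    obtain ⟨g, hg, hgeq⟩ := exists_extend_of_bounded isOpen_compl_singleton (by simp) hH₁d
      (by norm_num : (0:ℝ) < 1/2) hball (M := A * (1 + (1 + 1 / 2)) ^ (3 * k)) (fun w hw ↦ by
        have hw' := hball' hw
        rw [hH₁eq w hw']
        simp only [mem_compl_iff, mem_insert_iff, mem_singleton_iff, not_or] at hw'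
        refine (hgrowth w hw'.1 hw'.2).trans ?_
        have : ‖w‖ < 1 + 1 / 2 := by
          have h1 : dist w 1 < 1 / 2 := hw.1
          rw [dist_eq_norm] at h1
          have := norm_le_norm_add_norm_sub' w 1
          have := norm_sub_rev w 1
          linarith [norm_add_le (w - 1) 1, norm_one (α := ℂ),
            show ‖w‖ ≤ ‖w - 1‖ + ‖(1 : ℂ)‖ from by
              simpa using norm_add_le (w - 1) (1 : ℂ)]
        gcongr)
    refine ⟨g, ?_, fun w hw ↦ ?_⟩
    · have : ({1}ᶜ : Set ℂ) ∪ {1} = univ := compl_union_self _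
      rw [this] at hg
      exact differentiableOn_univ.mp hg
    · rw [hgeq w (fun h ↦ ?_), hH₁eq w hw]
      simp only [mem_compl_iff, mem_insert_iff, mem_singleton_iff, not_or] at hw
      exact hw.2 h
  -- `H₂` has polynomial growth, hence is a polynomial
  have hgrowth₂ : ∀ w : ℂ, 2 ≤ ‖w‖ → ‖H₂ w‖ ≤ A * (1 + ‖w‖) ^ (3 * k) := by
    intro w hw
    have hw0 : w ≠ 0 := fun h ↦ by rw [h, norm_zero] at hw; linarith
    have hw1 : w ≠ 1 := fun h ↦ by rw [h, norm_one] at hw; linarith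
    rw [hH₂eq w (by simp [hw0, hw1])]
    exact hgrowth w hw0 hw1
  obtain ⟨P, hPdeg, hP⟩ := exists_polynomial_of_norm_le_mul_pow hH₂d hgrowth₂
  refine ⟨P, hPdeg, fun τ hτ ↦ ?_⟩
  have hw : modularLambda τ ∈ ({0, 1}ᶜ : Set ℂ) := by
    simp [modularLambda_ne_zero hτ, modularLambda_ne_one hτ]
  rw [← hP, hH₂eq _ hw, hH, hFG τ hτ]
  ring

end ModularLambda

end Literature.NumberTheory.Automorphic

end
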